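import Summits.BirchSwinnertonDyer.Rank1Residual.X4.KolyvaginIndexRecordsKitOddPrime
import HarnessLib

/-!
# BSD rank-≤1 residual cell, lane class X4 (ADDITIVE at a prime `p ≥ 5`, `ρ̄_{E,p}` onto), rank ONE, KOLY-shaped (`p ∤ #E(ℚ)_tors·∏c·#Ш_an`):
# `BSD(E,p)` PER CELL from PUBLISHED theorems + Kolyvagin's HEEGNER-INDEX certificate `p ∤ [E(K):ℤy_K]` (two engines) through the unit's GEN
# 27 kit `X4.bsdp_prime_of_kolyvaginIndex_of_serreCounts`, `ρ̄_{E,p}` onto IN THE KERNEL — records 01 (x11c GEN 36 «J1-REMAINDER / KOLY-R»)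

HONEST FRAMING (cell `b2b-bsdres-*`, verbatim): prove what is provable now; shrink each hard class to its core with data; no claim beyond
stated classes; COMBINATION classes deleted from PUBLISHED theorems only, CONSTRUCTION-shaped remainder typed; this is not "finishing BSD".
X4 / X11b (and X11 ∧ r = 1 ∧ p = 3) stay CONSTRUCTION-SHAPED; everything here is PER CELL; no lane verdict is changed; NO named fact is
introduced (debt 0) and NO definition; nothing is booked by this file (bookings are referee A's, pub-bsdpct); Cremona's numbers (`r_an`,
`#Ш_an`, models, generators, `∏ c_ℓ`, torsion, optimality / Manin codes, the galrep datum) and the Kurihara lane's per-prime tables are INPUTS.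

Unit `b2b-bsdres-x11c`, GEN 36 (prover-b2b-bsdres-x11c-g36-0), move «J1-REMAINDER / KOLY-R». POPULATION (`HOME/b2b-bsdres-x11c/gen36/pop/`:
`census36.py` over referee A's ROUND 983 state of record × the Kurihara lane's sweep records × Cremona, then `build_pop36.py`): EVERY live
residue cell on the Kolyvagin / Jetchev road classes (X4, X7, X8, X11a, X11b), BOTH ranks, odd `p`, whose shape is KOLY (`ρ̄_{E,p}` onto,
`p ∤ #E(ℚ)_tors·∏c·#Ш_an`: 30 cells) or J1 (onto, `p ∤ #E(ℚ)_tors·#Ш_an`, exactly ONE prime `q ∣ N` with `p ∣ c_q`: 171 cells; the two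
J1 cells whose carrier is an ADDITIVE `p` have no door and are excluded) — 199 cells on 191 classes (188 of them with this cell as their ONLY
open cell): 82 rank-one `(3, X11b)`, 59 `(5, X4)` + 2 `(7, X4)` (rank one 19 / rank zero 42), 26 `(3, X4)` J1 (1 / 25), 20 `(3, X4)` KOLY
(6 / 14), 10 KOLY at `p ≥ 5`. The lane never certified them: at rank one its Heegner fields (`|D| ≤ 1511`) read `ord_p [E(K):ℤy_K] = w + 1`
or found no admissible field; at rank zero (additive `p`) no Heegner-index line was ever run. THIS UNIT ran the cell's engines VERBATIM in
DEEPER fields: engine 1 = gen 3 `engine1_cha1b/main.py` = x9-g7 `jobD1b.py` (cypari2, sha256 `69e29ec7…`; rank-one mode: Cremona's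
generator, `hy = L'(E,1)·L(E^D,1)·√|D|/(4·Area)`, `m = √(4·hy/ĥ(P))`; rank-zero mode: the rank-one twist `F = E^D`, a point `x ∈ F(ℚ)` by
`ellrank`, saturated, `hy = L(E,1)·L'(F,1)·√|D|/(4·Area)`, `m = √(4·hy/ĥ(x))` — Miller 2011 Thm. 4.1 / Cor. 4.8; `NDISC 16`, `DBOUND 6000`);
engine 2 = gen 3 `run_cert.py` (`1b54bb20…`) + `e2lib.py` + `tate_stdlib.py` (stdlib re-implementation: `m`, `ord_p m` must be EQUAL,
discrete checks); twist values = additive-p1 `twistvals/main.py` (`e501b988…`). Kit jobs: see HOME/b2b-bsdres-x11c/gen36/harvest/JOBS-gen36.txt. Evidence `HOME/b2b-bsdres-x11c/gen36/`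
(POP36.md, ROWS36-TABLE.md, harvest outputs with inputs.sha256, SHA256SUMS); REPORT.md §45.

THE ROAD (the unit's GEN 26/27/32 Kolyvagin route, class-agnostic, at `p ≥ 5`; referee A booked its X11b / X4 / X7 rows flag-free at pub-bsdpct
ROUNDS 429 / 651 / 835 / 839 in the KOLYD-r1 grammar): Kolyvagin's theorem as PRINTED by McCallum (LMS LN 153 (1991) §1) / Gross (ibid., Prop. 2.1 (2)) —
tree named facts `kolyvagin`, `Kolyvagin1990_padicValNat_card_sha_le` (registry A20; NOTHING about the reduction of `E` at `p`): `p ∤ [E(K):ℤy_K]` ⇒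
`Ш(E/K)[p] = 0` ⇒ `Ш(E/ℚ)[p] = 0`, and with `ord_p #Ш_an = 0` Miller's `BSD(E,p)` (`Typed.bsdp_of_kolyvagin_of_not_dvd_index`, `r_an ≤ 1`).
IN THE KERNEL per cell (kit `X4.bsdp_prime_of_kolyvaginIndex_of_serreCounts`, `X4/KolyvaginIndexRecordsKitOddPrime.lean`, p391900; every numeric
hypothesis a `decide` goal): `Δ ≠ 0`; global minimality of Cremona's model (bounded Kraus criterion, `|Δ| < 512¹²`); `ρ̄_{E,p}` ONTO by Serre's
Prop. 19 from THREE witness primes (schema point counts). DISPLAYED (binders, LETTER FOR LETTER the tuple of the unit's `X11b.bsdp_k<label>_<p>` /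
`X4.bsdp_k<label>_<p>` records): `hGZK`, `hKo` / `hB`, the Heegner datum (`K`, level `N`, `P` of infinite order, `p ∤ [E(K):ℤP]` — THIS UNIT's
two-engine datum, quoted per docstring, NOT re-computed here), `r_an ≤ 1`, `#Ш_an = q` with `ord_p q = 0`.
What a record is worth is the referee's call (EVIDENCE-grade certificate under displayed binders, as every Heegner-index record of the
cell). Cells in this file: `447300bg1`@5, `418950bw1`@7.

References: D. Jetchev, Compos. Math. 144 (2008) Thm. 1.4, Cor. 1.5 [Jetchev2008]; W. McCallum, LMS LN 153 (1991) §1, Cor. 5.6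
[McCallumLMS1991]; B. H. Gross, LMS LN 153 (1991) Prop. 2.1 [GrossLMS1991]; V. A. Kolyvagin (1990) [KolyvaginEulerSystems1990];
J.-P. Serre, Invent. Math. 15 (1972) §2.4 Prop. 15, §2.8 Prop. 19 [Serre1972]; J.-P. Serre, *Abelian ℓ-adic representations* IV-23
[SerreAbelianLadic1968]; B. H. Gross, D. Zagier, Invent. Math. 84 (1986) [GrossZagier1986]; R. L. Miller, LMS J. Comput. Math. 14 (2011)
Thm. 4.1, Cor. 4.8, Def. 1.1 [Miller2011LMS]; C. Wuthrich, Doc. Math. 19 (2014) Lemma 20 [Wuthrich2014]; J. H. Silverman, *AEC* (2009)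
VII.1, VII.5 [SilvermanAEC2009], *ATAEC* (1994) IV.9.4 [SilvermanATAEC1994]; A. Kraus, Acta Arith. 54 (1989) [Kraus1989]; Cremona's
tables [Cremona2006].
-/

set_option autoImplicit false

noncomputable section

open scoped Classical

open WeierstrassCurve Literature.NumberTheory.EllipticCurves
  Literature.NumberTheory.EllipticCurves.Rank1Residual
  Literature.NumberTheory.EllipticCurves.Rank1Residual.Typed
  Literature.NumberTheory.EllipticCurves.Rank1Residual.X11RankOneCertificates
  Summit.BirchSwinnertonDyer.BirchSwinnertonDyer.Rank1Residual.IntModel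
  Summit.BirchSwinnertonDyer.BirchSwinnertonDyer.Rank1Residual.X11RankOne
  Summit.BirchSwinnertonDyer.Rank1Residual.X4

namespace Summit.BirchSwinnertonDyer.Rank1Residual.X4

/-- **`BSD(E,5)` for `447300bg1`** (cell `(447300bg1, 5)`, class X4, rank 1; KOLYD grammar key `KOLY:447300bg1@5`); `N = 447300 = 2^2·3^2·5^2·7·71`,
additive `I6*` at `5`, `r_an = 1`, `#E(ℚ)_tors = 2`, `∏c = 8`, `#Ш_an = 1`, Cremona galrep: no code at this prime (`ρ̄_{E,5}` onto); `|Δ| = ∏` over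
`[(2, 4), (3, 9), (5, 12), (7, 1), (71, 1)]` (factored Kraus criterion, every disjunct decided). KOLY-shaped: `5 ∤ #E(ℚ)_tors·∏c·#Ш_an`; door
`X4.bsdp_prime_of_kolyvaginIndex_of_serreCounts` (the unit's GEN 27 kit, class-agnostic: Kolyvagin as printed, `5 ∤ [E(K):ℤy_K]` ⇒ `Ш(E/ℚ)[5] = 0`;
bounded Kraus minimality `|Δ| < 512¹²`); displayed certificate line `hI : ¬ 5 ∣ [E(K):ℤP]`. Serre Prop-19 witnesses mod `5`: (i) `ℓ₁ = 17`, `#Ẽ =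
16`, `r = 1`; (ii) `ℓ₂ = 11`, `#Ẽ = 8`; (iii) `ℓ₃ = 13`, `#Ẽ = 16`, `u = 3`. Kurihara lane note of record: «additive p, r=1». State of record
(referee A ROUND 983, `scratchA_A_state_after_x4gh_add3_onA2R977_fold.pkl`): class `residue`, 1 open cell(s), register empty. FLAG `opt-code-2`
(Cremona optimality code 2; `ρ̄_{E,5}` onto forbids a `5`-isogeny in the class, so `ord_5` of the index is class-invariant; the reading stands if
the optimal curve's Manin constant is prime to `5`). Other engine-1 fields tried (`D`: `m` (`ord_5 m`)): `-479`: `m = 40` (`ord = 1`). THIS UNIT'S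
DATUM (displayed, NOT re-computed here): DEEP FIELD `K = ℚ(√-1319)` (`1319` = prime): **`m = [E(K):ℤy_K] = 32`, `ord_5 m = 0`** (`ρ = m²/4`,
`L'(E,1) = 9.9089832339`, `L(E^D,1) = 1.5619891633`, `ĥ(P) = 23.165155290`; Cremona's generator) — engine 1 j293239 = engine 2 j294065: `m = 32`
EQUAL (FAIL:p2_not_div_N, dev ≤ 6.4e-15); twist `E^D` (j294066): `N = 778195095300`, `#tors·∏c·#Ш_an = 2·16·64`, `ord_5 #Ш_an(E^D) = 0`, `ord_5
∏c(E^D) = 0` (BSD-consistent). CONDITIONAL on every binder; per cell; nothing booked by this file.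
[cite: McCallumLMS1991, §1 Theorem (Kolyvagin), p. 296] [cite: GrossLMS1991, §2 Prop. 2.1 (2)] [cite: Serre1972, §2.8 Prop. 19] [cite: Cremona2006, Table 1 (label 447300bg1)] -/
theorem bsdp_k447300bg1_5 (hGZK : rank_eq_analyticRank_of_analyticRank_le_one) (W : WeierstrassCurve ℚ)
    (hW : W = ⟨0, 0, 0, 83700, -1258875⟩) {N : ℕ} [NeZero N] {K : Type} [Field K] [NumberField K]
    (hKo : kolyvagin N W K) (hB : Kolyvagin1990_padicValNat_card_sha_le N W K) (hK : IsImaginaryQuadratic K)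
    (hH : SatisfiesHeegnerHypothesis N K) {P : (W.baseChange K).toAffine.Point} (hP : IsHeegnerPoint N W K P)
    (hnt : ¬ IsOfFinAddOrder P) (hI : ¬ 5 ∣ (AddSubgroup.zmultiples P).index) (hr : W.analyticRank ≤ 1)
    {q : ℚ} (hq : shaAn W = (q : ℂ)) (hv : padicValRat 5 q = 0) : BSDp W 5 :=
  bsdp_prime_of_kolyvaginIndex_of_serreCounts 5 (by norm_num) (by norm_num) 0 0 0 83700 (-1258875) (by decide +kernel)
    (by decide +kernel) (by decide +kernel) 17 11 13 (by norm_num) (by norm_num) (by norm_num) (by norm_num)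
    (by norm_num) (by norm_num) (by norm_num) (by norm_num) (by norm_num) (by decide +kernel) (by decide +kernel)
    (by decide +kernel) (n₁ := 16) (n₂ := 8) (n₃ := 16) (hc₁ := by decide +kernel) (hc₂ := by decide +kernel)
    (hc₃ := by decide +kernel) (by decide +kernel) (by decide +kernel) (by decide +kernel) hGZK W
    (by rw [hW]; norm_num) hKo hB hK hH hP hnt hI hr hq hv

/-- **`BSD(E,7)` for `418950bw1`** (cell `(418950bw1, 7)`, class X4, rank 1; KOLYD grammar key `KOLY:418950bw1@7`); `N = 418950 = 2·3^2·5^2·7^2·19`,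
additive `I3*` at `7`, `r_an = 1`, `#E(ℚ)_tors = 1`, `∏c = 4`, `#Ш_an = 1`, Cremona galrep: no code at this prime (`ρ̄_{E,7}` onto); `|Δ| = ∏` over
`[(2, 7), (3, 3), (5, 8), (7, 9), (19, 3)]` (factored Kraus criterion, every disjunct decided). KOLY-shaped: `7 ∤ #E(ℚ)_tors·∏c·#Ш_an`; door
`X4.bsdp_prime_of_kolyvaginIndex_of_serreCounts` (the unit's GEN 27 kit, class-agnostic: Kolyvagin as printed, `7 ∤ [E(K):ℤy_K]` ⇒ `Ш(E/ℚ)[7] = 0`;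
bounded Kraus minimality `|Δ| < 512¹²`); displayed certificate line `hI : ¬ 7 ∣ [E(K):ℤP]`. Serre Prop-19 witnesses mod `7`: (i) `ℓ₁ = 13`, `#Ẽ =
16`, `r = 1`; (ii) `ℓ₂ = 17`, `#Ẽ = 24`; (iii) `ℓ₃ = 13`, `#Ẽ = 16`, `u = 3`. Kurihara lane note of record: «additive p, r=1». State of record
(referee A ROUND 983, `scratchA_A_state_after_x4gh_add3_onA2R977_fold.pkl`): class `residue`, 1 open cell(s), register empty. FLAG `opt-code-2`
(Cremona optimality code 2; `ρ̄_{E,7}` onto forbids a `7`-isogeny in the class, so `ord_7` of the index is class-invariant; the reading stands if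
the optimal curve's Manin constant is prime to `7`). Other engine-1 fields tried (`D`: `m` (`ord_7 m`)): `-839`: `m = 56` (`ord = 1`). THIS UNIT'S
DATUM (displayed, NOT re-computed here): DEEP FIELD `K = ℚ(√-1319)` (`1319` = prime): **`m = [E(K):ℤy_K] = 48`, `ord_7 m = 0`** (`ρ = m²/4`,
`L'(E,1) = 2.8952334615`, `L(E^D,1) = 0.9311895014`, `ĥ(P) = 8.2093786797`; Cremona's generator) — engine 1 j293228 = engine 2 j293889: `m = 48`
EQUAL (FAIL:p2_not_div_N, dev ≤ 5.4e-14); twist `E^D` (j293892): `N = 728872870950`, `#tors·∏c·#Ш_an = 1·8·36`, `ord_7 #Ш_an(E^D) = 0`, `ord_7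
∏c(E^D) = 0` (BSD-consistent). CONDITIONAL on every binder; per cell; nothing booked by this file.
[cite: McCallumLMS1991, §1 Theorem (Kolyvagin), p. 296] [cite: GrossLMS1991, §2 Prop. 2.1 (2)] [cite: Serre1972, §2.8 Prop. 19] [cite: Cremona2006, Table 1 (label 418950bw1)] -/
theorem bsdp_k418950bw1_7 (hGZK : rank_eq_analyticRank_of_analyticRank_le_one) (W : WeierstrassCurve ℚ)
    (hW : W = ⟨1, -1, 0, 1170258, -792455084⟩) {N : ℕ} [NeZero N] {K : Type} [Field K] [NumberField K]
    (hKo : kolyvagin N W K) (hB : Kolyvagin1990_padicValNat_card_sha_le N W K) (hK : IsImaginaryQuadratic K)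
    (hH : SatisfiesHeegnerHypothesis N K) {P : (W.baseChange K).toAffine.Point} (hP : IsHeegnerPoint N W K P)
    (hnt : ¬ IsOfFinAddOrder P) (hI : ¬ 7 ∣ (AddSubgroup.zmultiples P).index) (hr : W.analyticRank ≤ 1)
    {q : ℚ} (hq : shaAn W = (q : ℂ)) (hv : padicValRat 7 q = 0) : BSDp W 7 :=
  bsdp_prime_of_kolyvaginIndex_of_serreCounts 7 (by norm_num) (by norm_num) 1 (-1) 0 1170258 (-792455084) (by decide +kernel)
    (by decide +kernel) (by decide +kernel) 13 17 13 (by norm_num) (by norm_num) (by norm_num) (by norm_num)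
    (by norm_num) (by norm_num) (by norm_num) (by norm_num) (by norm_num) (by decide +kernel) (by decide +kernel)
    (by decide +kernel) (n₁ := 16) (n₂ := 24) (n₃ := 16) (hc₁ := by decide +kernel) (hc₂ := by decide +kernel)
    (hc₃ := by decide +kernel) (by decide +kernel) (by decide +kernel) (by decide +kernel) hGZK W
    (by rw [hW]; norm_num) hKo hB hK hH hP hnt hI hr hq hv

end Summit.BirchSwinnertonDyer.Rank1Residual.X4

end
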